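import Mathlib

/-!
# Venture HSemireg — (S5) OBSTRUCTION LOCUS away from secant type, III: coordinate sub-torus translates («REGIME A»),
# the sign-free rank of a monomial map, «single torus INJ», «disjoint pair KER 1», CRITERION A — uniform in `N`

HONEST FRAMING.  Part of the Lean side of the computation cell `pub-hsemireg` (track «S4-PUSH» (ii), seat s4-prove-2):
the torus-arrangement row of STRUCTURE.md §1.1 C7(d) / §2 (S-B) «UNIFORM LEMMA FORM (INJ n², …; pair KER 1)» and
G2-DEFORM-SANITY.md §C.1 (REGIME A, CRITERION A), typed and PROVED as finite combinatorics / linear algebra over an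
arbitrary field.  Nothing here constructs a variety or Bloch's semiregularity map; nothing here says that HC / HC_CM /
HC_AV holds; no Literature fact is declared or used.  REGIME A IS CLASS-DEAD (classes of torus-stable cycles are sums
of diagonal monomials `dz_S ∧ dz̄_S`, the Weil / secant component is isotropic — ref REVIEW-bench-factB-1): these rows
say WHERE NOT to look, and calibrate the engines; they decide nothing about the Weil component.

THE MODEL (G2-DEFORM-SANITY C.1; gs-eng-1 = habitat1 ×2).  `B_S = {x_k = t_k : k ∈ S} ⊂ E^N` is a translate of a
coordinate sub-torus of codimension `p = |S|`; `H¹(B_S, N_{B_S})` has the torus-weight basis `dz̄_i ⊗ ∂_k`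
(`i ∉ S`, `k ∈ S`; index type `BlochIndex S`, `card_blochIndex`: `(N − |S|)·|S|`), and Bloch's semiregularity map
`π : H¹(N_{B_S}) → H^{p−1,p+1}(E^N)` sends it to `± dz_{S∖k} ∧ dz̄_{S∪i}` — a SIGNED MONOMIAL, recorded here by its index
pair `blochTarget S (i,k) = (S.erase k, insert i S)`.  For a DISJOINT union `Z = ⊔_c B_{S_c}` (Bloch's pure-codimension
setting) `π_Z = ⊕_c π_{B_c}`.  Every rank / kernel statement below is proved for the abstract «monomial map»
`e_j ↦ ε_j • e_{f j}` with ARBITRARY non-zero `ε_j` (`monomialMap`), so no sign is ever evaluated (sign-free in the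
cell's sense): `finrank_range_monomialMap` — rank = number of distinct target monomials; `finrank_ker_monomialMap` —
`dim ker + #targets = #sources`.

PROVED HERE (kernel, every `N`, every `S`):
* `blochTarget_injective`, `finrank_ker_single` — **«single torus INJ»**: distinct basis vectors hit distinct monomials,
  `π_{B_S}` injective, `h¹(N) = rank = (N − |S|)|S|` (`= n²` at `|S| = n`, `N = 2n`).
* `blochTarget_eq_iff` — two distinct types share a target monomial iff `i = k'`, `i' = k`, `S ∖ k = S' ∖ k'`
  (a «near pair», `S △ S' = {k, k'}`); `near_iff_card_symmDiff` — for `|S| = |S'|` this is `|S △ S'| = 2`.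
* `image_inter_image_eq_singleton`, `finrank_ker_pair_of_near` — **«disjoint pair KER 1»**: a near pair shares EXACTLY
  one monomial, so `dim ker π_{B_S ⊔ B_{S'}} = 1`, rank `= h¹ + h¹' − 1` (`= 2n² − 1`).
* `sumElim_blochTarget_injective`, `finrank_ker_pair_of_not_near` — **CRITERION A (two components)**: not a near pair
  (`|S △ S'| ≥ 4` for equal sizes) ⟹ `π` injective on the pair: semiregular.
NOT here (cited in the tables, not re-derived): non-disjoint lci unions («nc 2-union INJ n² + 2n − 2» needs the
`T¹`-classes at the singular locus); parallel copies `S = S'` (all monomials shared; kernel = differences).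
References (dictionary only): Bloch 1972 §6–7 (the map `π`); cell files G2-DEFORM-SANITY.md §C.1/§D, WEIGHT-TABLES.md
C7(d), STRUCTURE.md §2 (S-B).
-/

open scoped BigOperators
open Finset

namespace Summit.Ventures.HSemireg.ObstructionLocus

variable {K : Type*} [Field K]

/-! ## Sign-free rank of a monomial map -/

section Monomial

variable {J M : Type*} [Fintype J] [DecidableEq M]

/-- A **monomial map**: the basis vector `e_j` goes to `ε_j • e_{f j}`.  (Bloch's `π` on a coordinate
sub-torus translate, and on disjoint unions of such, is of this shape with `ε_j = ±1`; every statement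
below holds for arbitrary non-zero `ε`, so no sign is ever evaluated.) -/
def monomialMap (f : J → M) (ε : J → K) : (J → K) →ₗ[K] (M → K) where
  toFun v m := ∑ j ∈ Finset.univ.filter (fun j => f j = m), ε j * v j
  map_add' v w := by
    funext m
    simp only [Pi.add_apply, mul_add, Finset.sum_add_distrib]
  map_smul' c v := by
    funext m
    simp only [Pi.smul_apply, smul_eq_mul, RingHom.id_apply, Finset.mul_sum]
    refine Finset.sum_congr rfl fun j _ => by ring

/-- Components of a monomial map. -/
theorem monomialMap_apply (f : J → M) (ε : J → K) (v : J → K) (m : M) :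
    monomialMap f ε v m = ∑ j ∈ Finset.univ.filter (fun j => f j = m), ε j * v j := rfl

variable [DecidableEq J]

/-- A monomial map on a basis vector. -/
theorem monomialMap_single (f : J → M) (ε : J → K) (j₀ : J) (c : K) :
    monomialMap f ε (Pi.single j₀ c) = Pi.single (f j₀) (ε j₀ * c) := by
  funext m
  rw [monomialMap_apply]
  by_cases hm : f j₀ = m
  · rw [Finset.sum_eq_single j₀]
    · simp [hm]
    · intro j _ hj; simp [hj]
    · intro h; exact absurd (by simp [hm]) h
  · rw [Finset.sum_eq_zero]
    · simp [hm]
    · intro j hj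
      simp only [Finset.mem_filter, Finset.mem_univ, true_and] at hj
      have : j ≠ j₀ := by rintro rfl; exact hm hj
      simp [this]

/-- The range of a monomial map with non-zero signs is the span of the target basis vectors it hits. -/
theorem range_monomialMap (f : J → M) {ε : J → K} (hε : ∀ j, ε j ≠ 0) :
    LinearMap.range (monomialMap f ε)
      = Submodule.span K (Set.range fun m : (Finset.univ.image f : Finset M) => Pi.single (M := fun _ => K) m.1 1) := by
  apply le_antisymm
  · rintro _ ⟨v, rfl⟩
    have hv : v = ∑ j, Pi.single (M := fun _ => K) j (v j) := (Finset.univ_sum_single v).symm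
    rw [hv, map_sum]
    refine Submodule.sum_mem _ fun j _ => ?_
    rw [monomialMap_single]
    have : Pi.single (M := fun _ => K) (f j) (ε j * v j) = (ε j * v j) • Pi.single (M := fun _ => K) (f j) 1 := by
      funext m
      by_cases hm : f j = m
      · subst hm; simp
      · simp [Ne.symm hm]
    rw [this]
    exact Submodule.smul_mem _ _ (Submodule.subset_span ⟨⟨f j, by simp⟩, rfl⟩)
  · rw [Submodule.span_le]
    rintro _ ⟨⟨m, hm⟩, rfl⟩
    obtain ⟨j, _, rfl⟩ := Finset.mem_image.1 hm
    refine ⟨Pi.single j (ε j)⁻¹, ?_⟩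
    rw [monomialMap_single, mul_inv_cancel₀ (hε j)]

variable [Fintype M]

/-- **Sign-free rank formula**: `rank = number of distinct target monomials hit`. -/
theorem finrank_range_monomialMap (f : J → M) {ε : J → K} (hε : ∀ j, ε j ≠ 0) :
    Module.finrank K (LinearMap.range (monomialMap f ε)) = (Finset.univ.image f).card := by
  rw [range_monomialMap f hε, finrank_span_eq_card]
  · exact Fintype.card_coe _
  · have hli := (Pi.basisFun K M).linearIndependent
    have : (fun m : (Finset.univ.image f : Finset M) => Pi.single (M := fun _ => K) m.1 (1 : K))
        = (Pi.basisFun K M) ∘ (fun m : (Finset.univ.image f : Finset M) => m.1) := by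
      funext m; simp [Pi.basisFun_apply]
    rw [this]
    exact hli.comp _ Subtype.val_injective

/-- **Kernel count**: `dim ker = (number of source basis vectors) − (number of distinct targets)`. -/
theorem finrank_ker_monomialMap (f : J → M) {ε : J → K} (hε : ∀ j, ε j ≠ 0) :
    Module.finrank K (LinearMap.ker (monomialMap f ε)) + (Finset.univ.image f).card = Fintype.card J := by
  have h := LinearMap.finrank_range_add_finrank_ker (monomialMap f ε)
  rw [finrank_range_monomialMap f hε, Module.finrank_fintype_fun_eq_card] at h
  omega

/-- Injective target assignment ⟹ the monomial map is injective (kernel `0`). -/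
theorem finrank_ker_monomialMap_of_injective {f : J → M} (hf : Function.Injective f) {ε : J → K}
    (hε : ∀ j, ε j ≠ 0) : Module.finrank K (LinearMap.ker (monomialMap f ε)) = 0 := by
  have h := finrank_ker_monomialMap f hε
  rw [Finset.card_image_of_injective _ hf, Finset.card_univ] at h
  omega

end Monomial

/-! ## (S-B)(d) REGIME A: coordinate sub-torus translates and Bloch's `π` (uniform in `N`) -/

section Torus

variable {N : ℕ}

/-- Index of the basis `dz̄_i ⊗ ∂_k` (`i ∉ S`, `k ∈ S`) of `H¹(B_S, N_{B_S})` for the translate `B_S ⊂ E^N` of the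
coordinate sub-torus `{x_k = const : k ∈ S}` (codimension `|S|`). -/
abbrev BlochIndex (S : Finset (Fin N)) : Type := {p : Fin N × Fin N // p.1 ∉ S ∧ p.2 ∈ S}

/-- `h¹(N_{B_S}) = (N − |S|)·|S|` (= `n²` for `|S| = n`, `N = 2n`: «single torus INJ n²»). -/
theorem card_blochIndex (S : Finset (Fin N)) : Fintype.card (BlochIndex S) = (N - S.card) * S.card := by
  rw [Fintype.card_congr (Equiv.subtypeProdEquivProd (p := fun i : Fin N => i ∉ S) (q := fun k : Fin N => k ∈ S)),
    Fintype.card_prod, Fintype.card_subtype_compl, Fintype.card_fin, Fintype.card_coe]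

/-- Bloch's `π` sends `dz̄_i ⊗ ∂_k` to `± dz_{S∖k} ∧ dz̄_{S ∪ i}`: record the target monomial by its index pair. -/
def blochTarget (S : Finset (Fin N)) (p : BlochIndex S) : Finset (Fin N) × Finset (Fin N) :=
  (S.erase p.1.2, insert p.1.1 S)

/-- **Single translate: distinct basis vectors hit distinct monomials** — `π_{B_S}` is injective
(«single torus INJ», every `N`, every `S`). -/
theorem blochTarget_injective (S : Finset (Fin N)) : Function.Injective (blochTarget S) := by
  rintro ⟨⟨i, k⟩, hi, hk⟩ ⟨⟨i', k'⟩, hi', hk'⟩ h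
  simp only [blochTarget, Prod.mk.injEq] at h
  obtain ⟨h1, h2⟩ := h
  have hkk : k = k' := by
    by_contra hne
    have : k' ∈ S.erase k := Finset.mem_erase.2 ⟨Ne.symm hne, hk'⟩
    rw [h1] at this
    exact Finset.notMem_erase k' S this
  have hii : i = i' := by
    have : i ∈ insert i' S := by rw [← h2]; exact Finset.mem_insert_self i S
    rcases Finset.mem_insert.1 this with h | h
    · exact h
    · exact absurd h hi
  subst hkk; subst hii; rfl

/-- **«single torus INJ»**: `π_{B_S}` has trivial kernel, whatever the signs. -/
theorem finrank_ker_single (S : Finset (Fin N)) {ε : BlochIndex S → K} (hε : ∀ j, ε j ≠ 0) :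
    Module.finrank K (LinearMap.ker (monomialMap (blochTarget S) ε)) = 0 :=
  finrank_ker_monomialMap_of_injective (blochTarget_injective S) hε

/-- **Collisions between two distinct types.** For `S ≠ S'`, `π(dz̄_i ⊗ ∂_k on B_S) = ± π(dz̄_{i'} ⊗ ∂_{k'} on B_{S'})`
iff `i = k'`, `i' = k` and `S ∖ k = S' ∖ k'` (so `S △ S' = {k, k'}`). -/
theorem blochTarget_eq_iff {S S' : Finset (Fin N)} (hSS' : S ≠ S') (p : BlochIndex S) (q : BlochIndex S') :
    blochTarget S p = blochTarget S' q ↔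
      (p.1.1 = q.1.2 ∧ q.1.1 = p.1.2 ∧ S.erase p.1.2 = S'.erase q.1.2) := by
  obtain ⟨⟨i, k⟩, hi, hk⟩ := p
  obtain ⟨⟨i', k'⟩, hi', hk'⟩ := q
  simp only [blochTarget, Prod.mk.injEq]
  constructor
  · rintro ⟨h1, h2⟩
    have hkk : k ≠ k' := by
      rintro rfl
      apply hSS'
      rw [← Finset.insert_erase hk, h1, Finset.insert_erase hk']
    have hk_i' : k = i' := by
      have : k ∈ insert i' S' := by rw [← h2]; exact Finset.mem_insert_of_mem hk
      rcases Finset.mem_insert.1 this with h | h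
      · exact h
      · exfalso
        have : k ∈ S'.erase k' := Finset.mem_erase.2 ⟨hkk, h⟩
        rw [← h1] at this
        exact Finset.notMem_erase k S this
    have hk'_i : k' = i := by
      have : k' ∈ insert i S := by rw [h2]; exact Finset.mem_insert_of_mem hk'
      rcases Finset.mem_insert.1 this with h | h
      · exact h
      · exfalso
        have : k' ∈ S.erase k := Finset.mem_erase.2 ⟨Ne.symm hkk, h⟩
        rw [h1] at this
        exact Finset.notMem_erase k' S' this
    exact ⟨hk'_i.symm, hk_i'.symm, h1⟩
  · rintro ⟨rfl, rfl, h1⟩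
    refine ⟨h1, ?_⟩
    rw [← Finset.insert_erase hk, ← Finset.insert_erase hk', h1, Finset.insert_comm]

/-- If the two types are not a «near pair» (no `k ∈ S`, `k' ∈ S'` with `S ∖ k = S' ∖ k'`, i.e. `S △ S' ≠ {k,k'}`),
the disjoint union `B_S ⊔ B_{S'}` has injective `π`: semiregular (CRITERION A, two components). -/
theorem sumElim_blochTarget_injective {S S' : Finset (Fin N)} (hSS' : S ≠ S')
    (h : ¬ ∃ k ∈ S, ∃ k' ∈ S', S.erase k = S'.erase k') :
    Function.Injective (Sum.elim (blochTarget S) (blochTarget S')) := by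
  rintro (p | p) (q | q) hpq
  · exact congr_arg Sum.inl (blochTarget_injective S hpq)
  · exfalso
    obtain ⟨-, -, h3⟩ := (blochTarget_eq_iff hSS' p q).1 hpq
    exact h ⟨p.1.2, p.2.2, q.1.2, q.2.2, h3⟩
  · exfalso
    obtain ⟨-, -, h3⟩ := (blochTarget_eq_iff hSS' q p).1 hpq.symm
    exact h ⟨q.1.2, q.2.2, p.1.2, p.2.2, h3⟩
  · exact congr_arg Sum.inr (blochTarget_injective S' hpq)

/-- CRITERION A, kernel form: not a near pair ⟹ `dim ker π_{B_S ⊔ B_{S'}} = 0`, whatever the signs. -/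
theorem finrank_ker_pair_of_not_near {S S' : Finset (Fin N)} (hSS' : S ≠ S')
    (h : ¬ ∃ k ∈ S, ∃ k' ∈ S', S.erase k = S'.erase k')
    {ε : BlochIndex S ⊕ BlochIndex S' → K} (hε : ∀ j, ε j ≠ 0) :
    Module.finrank K (LinearMap.ker (monomialMap (Sum.elim (blochTarget S) (blochTarget S')) ε)) = 0 :=
  finrank_ker_monomialMap_of_injective (sumElim_blochTarget_injective hSS' h) hε

/-- **Near pair ⟹ exactly ONE shared monomial** («disjoint pair KER 1»): if `S ∖ k = S' ∖ k'` with `k ∈ S`,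
`k' ∈ S'`, `S ≠ S'`, the images of `π_{B_S}` and `π_{B_{S'}}` meet in exactly the monomial
`dz_{S∖k} ∧ dz̄_{S ∪ k'}`. -/
theorem image_inter_image_eq_singleton {S S' : Finset (Fin N)} (hSS' : S ≠ S') {k k' : Fin N} (hk : k ∈ S)
    (hk' : k' ∈ S') (he : S.erase k = S'.erase k') :
    Finset.univ.image (blochTarget S) ∩ Finset.univ.image (blochTarget S')
      = {(S.erase k, insert k' S)} := by
  have hkk : k ≠ k' := by
    rintro rfl; apply hSS'; rw [← Finset.insert_erase hk, he, Finset.insert_erase hk']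
  have hk'S : k' ∉ S := by
    intro h
    have : k' ∈ S.erase k := Finset.mem_erase.2 ⟨Ne.symm hkk, h⟩
    rw [he] at this; exact Finset.notMem_erase k' S' this
  have hkS' : k ∉ S' := by
    intro h
    have : k ∈ S'.erase k' := Finset.mem_erase.2 ⟨hkk, h⟩
    rw [← he] at this; exact Finset.notMem_erase k S this
  let p₀ : BlochIndex S := ⟨(k', k), hk'S, hk⟩
  let q₀ : BlochIndex S' := ⟨(k, k'), hkS', hk'⟩
  ext m
  simp only [Finset.mem_inter, Finset.mem_image, Finset.mem_univ, true_and, Finset.mem_singleton]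
  constructor
  · rintro ⟨⟨p, hp⟩, ⟨q, hq⟩⟩
    have hpq := hp.trans hq.symm
    obtain ⟨h1, h2, h3⟩ := (blochTarget_eq_iff hSS' p q).1 hpq
    -- p = (k', k): from S.erase p.k = S'.erase q.k' and he, p.k ∈ S ∖ S' = {k}
    have hpk : p.1.2 = k := by
      by_contra hne
      have : p.1.2 ∈ S.erase k := Finset.mem_erase.2 ⟨hne, p.2.2⟩
      rw [he] at this
      have hpS' : p.1.2 ∈ S' := Finset.mem_of_mem_erase this
      -- but p.1.2 = q.1.1 ∉ S'
      exact q.2.1 (h2 ▸ hpS')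
    have hqk : q.1.2 = k' := by
      by_contra hne
      have : q.1.2 ∈ S'.erase k' := Finset.mem_erase.2 ⟨hne, q.2.2⟩
      rw [← he] at this
      have hqS : q.1.2 ∈ S := Finset.mem_of_mem_erase this
      exact p.2.1 (h1 ▸ hqS)
    rw [← hp]
    simp only [blochTarget, hpk, Prod.mk.injEq, true_and]
    rw [h1, hqk]
  · rintro rfl
    exact ⟨⟨p₀, rfl⟩, ⟨q₀, by
      simp only [blochTarget, q₀, Prod.mk.injEq]
      exact ⟨he.symm, by rw [← Finset.insert_erase hk, ← Finset.insert_erase hk', he, Finset.insert_comm]⟩⟩⟩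

/-- **«Disjoint pair KER 1»**: for a near pair the kernel of `π` on `H¹(N_{B_S}) ⊕ H¹(N_{B_{S'}})` is a line,
whatever the signs (rank `= h¹(N_{B_S}) + h¹(N_{B_{S'}}) − 1`, `= 2n² − 1` at `|S| = |S'| = n`, `N = 2n`). -/
theorem finrank_ker_pair_of_near {S S' : Finset (Fin N)} (hSS' : S ≠ S') {k k' : Fin N} (hk : k ∈ S)
    (hk' : k' ∈ S') (he : S.erase k = S'.erase k')
    {ε : BlochIndex S ⊕ BlochIndex S' → K} (hε : ∀ j, ε j ≠ 0) :
    Module.finrank K (LinearMap.ker (monomialMap (Sum.elim (blochTarget S) (blochTarget S')) ε)) = 1 := by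
  have h := finrank_ker_monomialMap (Sum.elim (blochTarget S) (blochTarget S')) hε
  have himg : (Finset.univ.image (Sum.elim (blochTarget S) (blochTarget S'))).card + 1
      = Fintype.card (BlochIndex S ⊕ BlochIndex S') := by
    have hi : Finset.univ.image (Sum.elim (blochTarget S) (blochTarget S'))
        = Finset.univ.image (blochTarget S) ∪ Finset.univ.image (blochTarget S') := by
      ext m; simp [Finset.mem_image, Sum.exists]
    have hci := Finset.card_union_add_card_inter (Finset.univ.image (blochTarget S))
      (Finset.univ.image (blochTarget S'))
    rw [image_inter_image_eq_singleton hSS' hk hk' he, Finset.card_singleton,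
      Finset.card_image_of_injective _ (blochTarget_injective S),
      Finset.card_image_of_injective _ (blochTarget_injective S'), Finset.card_univ, Finset.card_univ] at hci
    rw [hi, Fintype.card_sum]
    omega
  omega

/-- The near-pair condition in symmetric-difference form: for types of the same cardinality,
`(∃ k ∈ S, ∃ k' ∈ S', S ∖ k = S' ∖ k') ⟺ |S △ S'| = 2`.  Hence CRITERION A: a disjoint equal-codimension pair of
distinct types is `π`-injective iff `|S △ S'| ≥ 4` (the symmetric difference of equal-size sets is even). -/
theorem near_iff_card_symmDiff {S S' : Finset (Fin N)} (hSS' : S ≠ S') (hc : S.card = S'.card) :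
    (∃ k ∈ S, ∃ k' ∈ S', S.erase k = S'.erase k') ↔ (symmDiff S S').card = 2 := by
  have hsd : (symmDiff S S').card = (S \ S').card + (S' \ S).card := by
    rw [symmDiff_def, Finset.sup_eq_union, Finset.card_union_of_disjoint disjoint_sdiff_sdiff]
  have hcomm : (S \ S').card = (S' \ S).card := Finset.card_sdiff_comm hc
  constructor
  · rintro ⟨k, hk, k', hk', he⟩
    have hkk : k ≠ k' := by
      rintro rfl
      apply hSS'
      rw [← Finset.insert_erase hk, he, Finset.insert_erase hk']
    have h1 : S \ S' = {k} := by
      ext x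
      simp only [Finset.mem_sdiff, Finset.mem_singleton]
      constructor
      · rintro ⟨hxS, hxS'⟩
        by_contra hne
        have : x ∈ S.erase k := Finset.mem_erase.2 ⟨hne, hxS⟩
        rw [he] at this
        exact hxS' (Finset.mem_of_mem_erase this)
      · rintro rfl
        refine ⟨hk, fun h => ?_⟩
        have : x ∈ S'.erase k' := Finset.mem_erase.2 ⟨hkk, h⟩
        rw [← he] at this
        exact Finset.notMem_erase x S this
    rw [hsd, ← hcomm, h1, Finset.card_singleton]
  · intro h2
    have h1 : (S \ S').card = 1 := by omega
    have h1' : (S' \ S).card = 1 := by omega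
    obtain ⟨k, hk⟩ := Finset.card_eq_one.1 h1
    obtain ⟨k', hk'⟩ := Finset.card_eq_one.1 h1'
    have hkm : k ∈ S \ S' := by rw [hk]; exact Finset.mem_singleton_self k
    have hk'm : k' ∈ S' \ S := by rw [hk']; exact Finset.mem_singleton_self k'
    rw [Finset.mem_sdiff] at hkm hk'm
    refine ⟨k, hkm.1, k', hk'm.1, ?_⟩
    ext x
    simp only [Finset.mem_erase]
    constructor
    · rintro ⟨hxk, hxS⟩
      have hxS' : x ∈ S' := by
        by_contra hx
        have : x ∈ S \ S' := Finset.mem_sdiff.2 ⟨hxS, hx⟩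
        rw [hk, Finset.mem_singleton] at this
        exact hxk this
      exact ⟨fun h => hk'm.2 (h ▸ hxS), hxS'⟩
    · rintro ⟨hxk', hxS'⟩
      have hxS : x ∈ S := by
        by_contra hx
        have : x ∈ S' \ S := Finset.mem_sdiff.2 ⟨hxS', hx⟩
        rw [hk', Finset.mem_singleton] at this
        exact hxk' this
      exact ⟨fun h => hkm.2 (h ▸ hxS'), hxS⟩

end Torus

end Summit.Ventures.HSemireg.ObstructionLocus
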